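/-
Copyright: the b2b-balaban T⁴-continuum CRUX team, row NE7b OWNER lineage `t4-ne7b-p1` (gen 124). Project licence.
-/
import Summits.QuantumFields.BalabanUV.T4Continuum.Spine.NE7b.SupZdKernelInverseLimit

/-!
# KERNEL ALGEBRA ON `ℤ^d`, IV: DECAYING INVERSES ARE LIPSCHITZ IN THE ENTRIES — for bounded kernels `A, B` with a decaying left inverse `N_A`
# and a decaying right inverse `N_B`, and any entrywise weight `w ≥ |B − A|`: `|N_A − N_B|(b,b′) ≤ C_N²Σ′e^{−ν|b−c|₁}w(c,c′)e^{−ν|b′−c′|₁}`, and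
# with a constant weight `|N_A − N_B| ≤ C_N²K_ν²·sup|B − A|` — the quantitative companion of (227)'s limit theorem (the weighted form is what a
# torus → `ℤ^d` SEAM estimate feeds: weights concentrated near the seam); (227) resolvent identity + triangle inequality (row NE7b, node
# U5c; (189)∕(191)∕(227) BY NAME; [folklore])

Cell `pub-balaban`, sub-cell `t4`, spine estimate NE7b (`T4WeightBudget.RelWeightBound`; the cell's OWN estimate — NOT PRINTED in
[Bałaban 1983–89], NOT PROVED).  Crux-route work under `Spine/NE7b/` by the row OWNER (`t4-ne7b-p1` gen 124, file (228)) under FREEZE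
(0)'s crux-prover clause; NOTHING of Bałaban's is named as a Lean object, valued or asserted; no `T4Continuum/Support` leaf typed; no `def`,
no notation; zero `sorry`; no road object (pure kernel algebra).  Imports (BY NAME): the OWNER's (227) `…SupZdKernelInverseLimit`
(`resolvent_identity`; through it (189) `summable_exp_l1`, `tsum_exp_l1_le`, (191) `natAbs_sub_comm_sum`), Mathlib's `Summable.tsum_prod`,
`Summable.tsum_mul_tsum`, `Summable.mul_of_nonneg`, `norm_tsum_le_tsum_norm`.

WHY (located).  The ADDENDUM's NEXT item (b) with a RATE: (199) proved `|T_k⁻¹(σ_kb, σ_kb′) − M(b,b′)| ≤ Ce^{−δ·margin}` for `T_0` through [B4]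
(5.10); for `T_K` the same will follow from a seam estimate `|T_k − T_K|(c,c′) ≤ w_k(c,c′)` (small away from the seam) and the present
weighted Lipschitz bound, with (226) supplying the uniform decay of the torus-side inverses.  The unweighted form (ii) is the sup-norm
statement `‖N_A − N_B‖_∞ ≤ C_N²K_ν²‖A − B‖_∞` in the decaying class.

WHAT IS PROVED ([folklore]): §1 **`inverse_lipschitz`** (THE END: (i) the weighted bound for every admissible weight; (ii) the constant-weight
bound `C_N²K_ν²η`); §2 toy.

HONEST (what this is NOT).  Abstract; the seam weights of the `H + K` torus column are NOT computed here; nothing of the covariant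
propagators of [B4]–[B6]; nothing of Bałaban's asserted.  BY-NAME EFFECT ON THE WALL: NONE.  NE7b NOT PRINTED ∕ NOT PROVED; spine PROVED
0∕9; rung (B)+1 — the programme's measures remain FINITE-torus statements; NOT the mass gap, NOT Clay.  HONEST DEPENDENCY: continuum YM on
T⁴ ⇐ BetaPertH ∧ nine spine estimates (0∕9 proved); BetaPertH ⇐ (D1) ∧ (D4) ∧ CAP+tail; G-an2-4 gates asym, D1 and NE2∕3∕4.
-/

set_option autoImplicit false

noncomputable section

namespace Summit.QuantumFields.BalabanUV.T4Continuum.NE7b.SupZdKernelInverseLipschitz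

open Real Filter Topology
open scoped ENNReal
open Literature.MathematicalPhysics.QuantumFieldTheory.Balaban1983to89
open B6QGQLower276 (X)
open SupZdExponentialSums (summable_exp_l1 tsum_exp_l1_le)
open SupZdCoarseForm (natAbs_sub_comm_sum)
open SupZdKernelInverseLimit (resolvent_identity)

variable {d : ℕ}

/-! ## §1. THE END: the inverse is Lipschitz in the entries, with weights -/

/-- **HEADLINE — DECAYING INVERSES ARE LIPSCHITZ IN THE ENTRIES**: `A, B` bounded kernels on `ℤ^d` (`|A|, |B| ≤ C_A`), `N_A` a decaying left
inverse of `A`, `N_B` a decaying right inverse of `B` (`|N_·(b,c)| ≤ C_Ne^{−ν|b−c|₁}`), and a WEIGHT `w ≥ |B − A|` entrywise with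
`Σ′_cΣ′_{c′}e^{−ν|b−c|₁}w(c,c′)e^{−ν|b′−c′|₁} < ∞`: (i) `|N_A(b,b′) − N_B(b,b′)| ≤ C_N²·Σ′_{(c,c′)}e^{−ν|b−c|₁}w(c,c′)e^{−ν|b′−c′|₁}`; (ii) with the
constant weight `w ≡ η`: `|N_A(b,b′) − N_B(b,b′)| ≤ C_N²K_ν²·η` (`K_ν = (2∕(1−e^{−ν}))^d`) — the resolvent identity (227) and the triangle
inequality; (i) is the form the torus → `ℤ^d` seam estimates feed (weights concentrated near the seam), (ii) the plain sup-norm Lipschitz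
bound. [folklore] -/
theorem inverse_lipschitz {CA Cn ν : ℝ} (hCA : 0 ≤ CA) (hCn : 0 ≤ Cn) (hν : 0 < ν) (A B NA NB : X d → X d → ℝ)
    (hA : ∀ c c', |A c c'| ≤ CA) (hB : ∀ c c', |B c c'| ≤ CA)
    (hNA : ∀ b c, |NA b c| ≤ Cn * exp (-(ν * ∑ i, (((b i - c i).natAbs : ℕ) : ℝ))))
    (hNB : ∀ b c, |NB b c| ≤ Cn * exp (-(ν * ∑ i, (((b i - c i).natAbs : ℕ) : ℝ))))
    (hNAA : ∀ b c', ∑' c : X d, NA b c * A c c' = if b = c' then 1 else 0)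
    (hBNB : ∀ c b', ∑' c' : X d, B c c' * NB c' b' = if c = b' then 1 else 0) (b b' : X d) :
    (∀ (w : X d → X d → ℝ), (∀ c c', |B c c' - A c c'| ≤ w c c') →
      Summable (fun x : X d × X d => exp (-(ν * ∑ i, (((b i - x.1 i).natAbs : ℕ) : ℝ))) * w x.1 x.2
        * exp (-(ν * ∑ i, (((b' i - x.2 i).natAbs : ℕ) : ℝ)))) →
      |NA b b' - NB b b'| ≤ Cn ^ 2 * ∑' x : X d × X d, exp (-(ν * ∑ i, (((b i - x.1 i).natAbs : ℕ) : ℝ))) * w x.1 x.2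
        * exp (-(ν * ∑ i, (((b' i - x.2 i).natAbs : ℕ) : ℝ)))) ∧
    (∀ η : ℝ, (∀ c c', |B c c' - A c c'| ≤ η) →
      |NA b b' - NB b b'| ≤ Cn ^ 2 * ((2 * (1 - exp (-ν))⁻¹) ^ d) ^ 2 * η) := by
  classical
  obtain ⟨hs, hid⟩ := resolvent_identity (d := d) hCA hCn hν A B NA NB hA hB hNA hNB hNAA hBNB b b'
  have hNBc : ∀ c', |NB c' b'| ≤ Cn * exp (-(ν * ∑ i, (((b' i - c' i).natAbs : ℕ) : ℝ))) := fun c' => by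
    rw [natAbs_sub_comm_sum]; exact hNB c' b'
  -- the difference as ONE series over `ℤ^d × ℤ^d`
  have hone : NA b b' - NB b b' = ∑' x : X d × X d, NA b x.1 * (B x.1 x.2 - A x.1 x.2) * NB x.2 b' := by
    rw [hid, hs.tsum_prod]
  have hgen : ∀ (w : X d → X d → ℝ), (∀ c c', |B c c' - A c c'| ≤ w c c') →
      Summable (fun x : X d × X d => exp (-(ν * ∑ i, (((b i - x.1 i).natAbs : ℕ) : ℝ))) * w x.1 x.2
        * exp (-(ν * ∑ i, (((b' i - x.2 i).natAbs : ℕ) : ℝ)))) →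
      |NA b b' - NB b b'| ≤ Cn ^ 2 * ∑' x : X d × X d, exp (-(ν * ∑ i, (((b i - x.1 i).natAbs : ℕ) : ℝ))) * w x.1 x.2
        * exp (-(ν * ∑ i, (((b' i - x.2 i).natAbs : ℕ) : ℝ))) := by
    intro w hw hws
    rw [hone]
    have h1 : |∑' x : X d × X d, NA b x.1 * (B x.1 x.2 - A x.1 x.2) * NB x.2 b'|
        ≤ ∑' x : X d × X d, |NA b x.1 * (B x.1 x.2 - A x.1 x.2) * NB x.2 b'| := by
      have := norm_tsum_le_tsum_norm hs.norm; simpa only [Real.norm_eq_abs] using this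
    have hpt : ∀ x : X d × X d, |NA b x.1 * (B x.1 x.2 - A x.1 x.2) * NB x.2 b'|
        ≤ Cn ^ 2 * (exp (-(ν * ∑ i, (((b i - x.1 i).natAbs : ℕ) : ℝ))) * w x.1 x.2
          * exp (-(ν * ∑ i, (((b' i - x.2 i).natAbs : ℕ) : ℝ)))) := by
      intro x
      rw [abs_mul, abs_mul]
      have hw0 : 0 ≤ w x.1 x.2 := (abs_nonneg _).trans (hw x.1 x.2)
      calc |NA b x.1| * |B x.1 x.2 - A x.1 x.2| * |NB x.2 b'|
          ≤ (Cn * exp (-(ν * ∑ i, (((b i - x.1 i).natAbs : ℕ) : ℝ)))) * w x.1 x.2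
            * (Cn * exp (-(ν * ∑ i, (((b' i - x.2 i).natAbs : ℕ) : ℝ)))) :=
            mul_le_mul (mul_le_mul (hNA b x.1) (hw x.1 x.2) (abs_nonneg _) (by positivity)) (hNBc x.2) (abs_nonneg _)
              (mul_nonneg (by positivity) hw0)
        _ = _ := by ring
    have h2 := hs.abs.tsum_le_tsum hpt (hws.mul_left _)
    rw [tsum_mul_left] at h2
    exact h1.trans h2
  refine ⟨hgen, fun η hη => ?_⟩
  have hη0 : 0 ≤ η := (abs_nonneg _).trans (hη b b)
  -- the constant weight: the double series factorises into `K_ν·η·K_ν`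
  have hprod : Summable fun x : X d × X d => exp (-(ν * ∑ i, (((b i - x.1 i).natAbs : ℕ) : ℝ))) * η
      * exp (-(ν * ∑ i, (((b' i - x.2 i).natAbs : ℕ) : ℝ))) :=
    Summable.mul_of_nonneg ((summable_exp_l1 hν b).mul_right η) (summable_exp_l1 hν b')
      (fun _ => by positivity) (fun _ => by positivity)
  have h := hgen (fun _ _ => η) hη hprod
  refine h.trans ?_
  have hKν : 0 ≤ (2 * (1 - exp (-ν))⁻¹) ^ d := pow_nonneg (mul_nonneg zero_le_two (inv_nonneg.2 (sub_nonneg.2 (exp_le_one_iff.2 (by linarith))))) d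
  have hfact : ∑' x : X d × X d, exp (-(ν * ∑ i, (((b i - x.1 i).natAbs : ℕ) : ℝ))) * η
      * exp (-(ν * ∑ i, (((b' i - x.2 i).natAbs : ℕ) : ℝ)))
      = (∑' c : X d, exp (-(ν * ∑ i, (((b i - c i).natAbs : ℕ) : ℝ))) * η)
        * ∑' c' : X d, exp (-(ν * ∑ i, (((b' i - c' i).natAbs : ℕ) : ℝ))) :=
    ((summable_exp_l1 hν b).mul_right η).tsum_mul_tsum (summable_exp_l1 hν b') hprod |>.symm
  rw [hfact, tsum_mul_right]
  have e1 := tsum_exp_l1_le (d := d) hν b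
  have e2 := tsum_exp_l1_le (d := d) hν b'
  have hS0 : 0 ≤ ∑' c' : X d, exp (-(ν * ∑ i, (((b' i - c' i).natAbs : ℕ) : ℝ))) := tsum_nonneg fun _ => (exp_pos _).le
  calc Cn ^ 2 * ((∑' c : X d, exp (-(ν * ∑ i, (((b i - c i).natAbs : ℕ) : ℝ)))) * η
        * ∑' c' : X d, exp (-(ν * ∑ i, (((b' i - c' i).natAbs : ℕ) : ℝ))))
      ≤ Cn ^ 2 * ((2 * (1 - exp (-ν))⁻¹) ^ d * η * (2 * (1 - exp (-ν))⁻¹) ^ d) := by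
        refine mul_le_mul_of_nonneg_left ?_ (by positivity)
        exact mul_le_mul (mul_le_mul_of_nonneg_right e1 hη0) e2 hS0 (by positivity)
    _ = _ := by ring

/-! ## §2. Toy -/

/-- Toy (`d = 2`, `ν = 1`): the row constant behind (ii) dominates the unit-rate exponential sum around the origin of `ℤ²`. -/
example : ∑' c : X 2, exp (-(1 * ∑ i, ((((0 : X 2) i - c i).natAbs : ℕ) : ℝ))) ≤ (2 * (1 - exp (-1))⁻¹) ^ 2 :=
  tsum_exp_l1_le (d := 2) one_pos 0

end Summit.QuantumFields.BalabanUV.T4Continuum.NE7b.SupZdKernelInverseLipschitz
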